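import Mathlib
import HarnessLib
import HarnessLib.Audit
import Summits.ValiantsHypothesis.Statement
import Summits.ValiantsHypothesis.ValiantsHypothesis.Theorems.SymmetroidDescartesThetaPencilWitnessTheta
import Literature.Computability.AlgebraicComplexity.ValiantConjectureEquivProofs
import Literature.Computability.AlgebraicComplexity.ArithCircuitProofs
import Literature.Computability.AlgebraicComplexity.RealTauConjectureDepthFour
import Literature.Computability.AlgebraicComplexity.DeterminantalIdealComplexityDescent
import Literature.Computability.AlgebraicComplexity.ConstantFreeValiant
import Literature.Barriers.ValiantsHypothesis.MonotoneGap
import Summits.ValiantsHypothesis.ValiantsHypothesis.Theorems.TameSensitivityQuantHrubes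
import Summits.ValiantsHypothesis.ValiantsHypothesis.Theorems.TameSensitivityTameGrowth

/-!
Route: TameSensitivity

DORMANT since 2026-09-04T13:53:22Z (reconciler: no traction for 5 d (last activity statement-closed at 2026-08-30T13:01:39Z); parked, not closed — `ledger route dormant route-ValiantsHypothesis-TameSensitivity --off` to reactivate) — unstaffed, not closed; items shared with open routes are served there. `ledger route dormant <id> --off` reactivates.

# Route TameSensitivity — VP≠VNP ⟸ budgeted ε-sensitive monotone hardness of per ∧ collapse ⇒ tame
circuits for per

It suffices to show X = A ∧ B1a together with two provable-now lemmas B2, B1b. RESTRICTED MODEL of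
the line: TAME circuits =
fan-in-two real circuits whose Hrubeš radius (abs-value circuit evaluated at the all-ones point) is
≤ 2^(n^C + C).
A = SensitiveHardPoly: for every budget C and p-bounded s, some n admits NO ε ∈ [2^-(n^C+C), 1] with
(1+Σ x_ij)^n + ε·per_n
monotone-computable (Jerrum–Snir model, `IsMonotoneComputation`) in size s n. B1a = SmallConstPer:
if per is p-computable over ℝ then by
fan-in-two circuits with constants/weights of modulus ≤ 2^(n^C+C) and formal degrees ≤ n^C+C. B2 =
QuantHrubesPer (Hrubeš 2020 Thm 1 for per
with explicit threshold ε₀ ≥ 1/radius), B1b = TameGrowth (small constants + poly formal degree ⇒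
single-exponential radius). Then
A ∧ B2 ⇒ per has no p-size tame circuits (PerNotTame), B1a ∧ B1b ⇒ (collapse ⇒ per has p-size tame
circuits), contradiction ⇒ per not
p-computable over ℝ ⇔ VP ≠ VNP over ℂ (tree: realification
`SymmetroidDescartes.isPComputable_perPoly_real_of_complex` + `perNotPComputableComplex_iff_holds`).
Decomposition-workshop node (decomp-valiant cycle 1, lens 6,
restricted-models lifting axis); every open piece is implied by S (kernel theorems in the node file)
and none is known to imply S.
Lean: `(∀ (C : ℕ) (s : ℕ → ℕ), Literature.Computability.AlgebraicComplexity.IsPBounded s → ∃ n : ℕ,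
∀ ε : ℝ, ((2 : ℝ) ^ (n ^ C + C))⁻¹ ≤ ε → ε ≤ 1 → ¬ ∃ (g : MvPolynomial (Fin n × Fin n) NNReal) (P :
Literature.Computability.AlgebraicComplexity.ArithCircuit NNReal (Fin n × Fin n)), MvPolynomial.map
NNReal.toRealHom g = (1 + ∑ ij : Fin n × Fin n, MvPolynomial.X ij) ^ n + MvPolynomial.C ε *
Literature.Computability.AlgebraicComplexity.perPoly (Fin n) ℝ ∧
Literature.Barriers.ValiantsHypothesis.IsMonotoneComputation P g ∧ P.size ≤ s n) ∧
(Literature.Computability.AlgebraicComplexity.IsPComputable (fun n =>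
Literature.Computability.AlgebraicComplexity.perPoly (Fin n) ℝ) → ∃ (C : ℕ) (s : ℕ → ℕ),
Literature.Computability.AlgebraicComplexity.IsPBounded s ∧ ∀ n : ℕ, ∃ P :
Literature.Computability.AlgebraicComplexity.ArithCircuit ℝ (Fin n × Fin n), P.IsFanInTwo ∧ (∀ g ∈
P.gates, 1 ≤ g.fanIn) ∧ P.Computes (Literature.Computability.AlgebraicComplexity.perPoly (Fin n) ℝ)
∧ P.size ≤ s n ∧ (∀ c ∈ P.consts, |c| ≤ (2 : ℝ) ^ (n ^ C + C)) ∧ (∀ d ∈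
Literature.Computability.AlgebraicComplexity.ArithCircuit.gateFormalDegrees P.gates, d ≤ n ^ C + C)
∧ P.formalDegree ≤ n ^ C + C)`

## Assembly
Pure logic plus p-boundedness bookkeeping (sorry-free in the node file, theorem `closes_tame`):
assume per p-computable over ℝ; B1a gives
C, s and circuits P_n with small constants and formal degrees; B1b bounds their radius by 2^e(n)
with e(n) = (n^C+C+1)(n^C+C)(s n+2), a
p-bounded function, so radius ≤ 2^(n^c'+c'); A at budget c' and size bound t n (s n) (p-bounded by
B2) yields an n where no ε in the window
works; but B2 at ε = 2^-(n^c'+c') (ε·radius ≤ 1) produces such a monotone computation —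
contradiction; hence per is not p-computable over ℝ,
which is VP ≠ VNP over ℂ by realification
`Summit.ValiantsHypothesis.ValiantsHypothesis.Theorems.SymmetroidDescartes.isPComputable_perPoly_real_of_complex`
(Hrubeš–Yehudayoff 2011 Thm 4.2) and `perNotPComputableComplex_iff_holds`.

Rationale: WHY THIS LINE. Hrubeš 2020 (Thm 1; ECCC TR19-034 pp.18–20) makes monotone lower bounds universal
after an ε-perturbation, and his threshold is
ε₀ = 1/R with R the abs-value evaluation of the circuit at the all-ones point — an ARCHIMEDEAN
MAGNITUDE. Indexing sensitivity by the
magnitude budget 2^-(n^C+C) splits VP≠VNP into a budgeted monotone lower bound for per (A; reachable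
from the only superpolynomial
lower bounds we own: Jerrum–Snir 1982 §4.3 PROVED in the tree, ε-sensitive bounds CDM21 Thm 1.2 /
CDGM22 doi:10.4230/lipics.fsttcs.2022.12
in print for other families) and a numerical-analysis statement (collapse ⇒ per computable with
single-exponential radius), whose open core
B1a is the per-instance, conditional shadow of Bürgisser's constant problem (Burgisser2000 Ch. 4;
NumTame.MagnitudeNF; Koiran–Perifel 2011)
and whose floor at doubly-exponential radius is real algebraic geometry (BPR 2006 Thm 13.15).
Imported areas: monotone/communication-complexity
lower bounds (discrepancy, corruption), real algebraic geometry (ball meeting components),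
arithmetic of constants (heights). What it does
that prior routes do not: CirculantFourier uses Hrubeš's bridge in the ∃ε₀ form for a circulant
product and has no magnitude piece;
NumTame uses tameness with a Boolean hypothesis (NP ⊄ P/poly) and cube values instead of the radius;
the census's monotone row (C4) has
only JS + the REFUTED class transfer; the negatives index has no monotone/tame statement.

RANKED CRUXES. #2 SmallConstPer (crux) — B1a — if per is p-computable over ℝ, then it is
p-computable by fan-in-two real circuits (gates of fan-in ≥ 1) whose constants and sum weights have
modulus ≤ 2^(n^C + C) and whose formal degrees are ≤ n^C + C, for some C. [difficulty: open-problem]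
(why it might fail: large constants may genuinely help per under collapse: constant elimination
(arithmetic Bézout) only yields height 2^(2^poly) for a fixed skeleton, and no collapse-to-magnitude
mechanism is known (Koiran–Perifel 2011 Rem. 4).) [Burgisser2000, Burgisser2009, arXiv:0710.0360,
doi:10.1007/3-540-33099-2]
#3 SensitiveHardPoly (crux) — A — for every C and every p-bounded s there is an n such that for NO ε
with 2^-(n^C+C) ≤ ε ≤ 1 does (1 + Σ_ij x_ij)^n + ε·per_n admit a Jerrum–Snir monotone computation of
size ≤ s n (budgeted ε-sensitive monotone hardness of the permanent, infinitely often). [difficulty: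
open-problem] (why it might fail: U_n has full support, so every support-based monotone method is
blind (Hrubeš 2020 p.6); discrepancy methods (CDM21/CDGM22) need a rectangle anti-concentration
bound for per that is not in print; at large C it is as hard as per ∉ VP-with-radius-2^poly.)
[Hrubes2020, doi:10.4230/lipics.fsttcs.2022.12, JerrumSnir1982, Yehudayoff2019]
#9 QuantHrubesPer (support) — B2 — Hrubeš's Theorem 1 for per_n with explicit threshold: a
p-bounded-preserving overhead t such that every fan-in-two real circuit of size ≤ m computing per_n
gives, for every 0 < ε ≤ 1 with ε·radius ≤ 1, a monotone computation of (1+Σx)^n + ε·per_n of size ≤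
t n m (radius = abs-value circuit at the all-ones point; Hrubeš's proof has ε₀ = 1/R ≥ 1/radius).
[difficulty: provable-now] [Hrubes2020]
#9 TameGrowth (support) — B1b — growth lemma for the radius: a fan-in-two real circuit with gates of
fan-in ≥ 1, constants and weights of modulus ≤ 2^R and all formal degrees ≤ D has abs-value
evaluation at the all-ones point ≤ 2^((R+1)·D·(size+2)) (induction over the gate list;
abs-evaluation twin of NumTame.MagnitudeGlue). [difficulty: provable-now] [Burgisser2000,
Burgisser2009]

TWO-LAYER PLAN. SensitiveHardPoly ⇐ rungs SensitiveHardAt C (one budget at a time) and the bottom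
rung SensitiveHardAtOne ((1+Σx)^n + per_n not monotone
p-computable = the (1+Σx)^n-form of Hrubeš 2020 §6 Open Problem 1), each a glued child later;
SmallConstPer ⇐ (collapse ⇒ per ∈ VP⁰-type
normal form with poly formal degree, via VNP⁰-completeness under collapse, Bürgisser 2009 Thm 2.10)
→ (height-to-modulus for algebraic
constants) → SmallConstPer; nothing filed now.

KILL CRITERIA. A refutation of SensitiveHardPoly (a budget C and p-bounded monotone computations of
(1+Σx)^n + ε_n per_n for all n at some ε_n ≥ 2^-(n^C+C))
would, by the node's kernel theorem sensitiveHardPoly_of_summit, REFUTE VP≠VNP itself — so in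
practice kills come from the other side:
SmallConstPer refuted (collapse-consistent magnitude lower bound for per, e.g. per ∈ VP forces
constants of modulus 2^(2^Ω(n))) closes the
route `refuted:SmallConstPer` and retires the magnitude axis; TameGrowth or QuantHrubesPer failing
as typed = misstatement, repair by restate.
NumTame.MagnitudeNF proved elsewhere makes SmallConstPer a corollary; a proof of per ∉ VP by any
route moots everything.

NOT DECOMPOSED YET. The discrepancy/anti-concentration lemma for per under balanced set-multilinear
rectangles (child of SensitiveHardPoly); the exact
overhead t n m = K(m n² + n² log n + 1) in QuantHrubesPer (left existential); uniformity/field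
issues (ℝ vs ℂ handled by the tree bridge);
any Boolean or GRH input (deliberately none).

CHEAPEST FALSIFIER. Extract ε₀ from the tree's proof `Hrubes2020_sensitive_holds`: if the proved
threshold is NOT ≥ 1/(abs-value evaluation at 1) up to the
stated size overhead, QuantHrubesPer is misstated (repair: replace radius by the proof's R). Second:
small-n search — monotone complexity of
(1+Σx)^2 + ε per_2 vs (1+Σx)^2 for ε ∈ {1, 1/4} (a few core-minutes; not run, kit disallowed in this
seat).

NUMBERS. Jerrum–Snir: monotone complexity of per_n ≥ n(2^(n-1) - 1) (tree
JerrumSnir1982_permanent_holds). Hrubeš: size O(s d² + n log n), ε₀ = 1/R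
(TR19-034 pp.19–20). CDGM22: sensitivity down to ε ≥ 2^-Ω(n) for graph inner-product polynomials;
class transfer at that rate refuted in the
tree (not_sensitiveTransfer, witness ST ∈ VP). BPR 2006 Thm 13.15: ball radius 2^(τ·O(d)^k). Items
at open: 5 (2 cruxes, 2 supports, assembly).

DEFINITION REQUESTS. None: ArithCircuit.mapConsts, consts, gateFormalDegrees, formalDegree,
IsMonotoneComputation, perPoly, IsPComputable exist.

Novelty: Searches (2026-08-29): lit search --hybrid "sensitive monotone permanent Hrubes open problem" (1
relevant: paper:galaxy-pdf-8480837716326541740);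
lit search --hybrid "monotone arithmetic circuit lower bound epsilon-sensitive transparent
polynomial" (8: CDM21 galaxy-pdf-6569535347425970800,
CDGM22, CCC21-9, Yehudayoff, robust sunflowers); lit search "robustly separating monotone hierarchy
graph inner-product" (held doi-10-4230-lipics-fsttcs-2022-12);
lit search --hybrid "real algebraic set sample points bit size ball radius Basu Pollack Roy"
(book:basu2006 Thm 13.15 read p.526);
lit vsearch "if VP equals VNP then the permanent can be computed … small integer constants VP0" (0
docs); lit galaxy search
"ε-sensitive|epsilon-sensitive|sensitive monotone" --star all (pdf: Hrubeš TR19-034, CDM ECCC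
TR20-166; rest noise); lit galaxy search
"VP0|constant-free|tau-conjecture" --star pdf (noise); ledger negatives (32, none monotone/tame);
tree: Theses/CirculantFourier, NumTame, MonotoneRestoration read.
Nearest prior art found: Hrubeš 2020 (paper:galaxy-pdf-8480837716326541740, Thm 1 + §6 OP1: ∃ε₀
form, per question at ε = 1);
CDGM22 doi:10.4230/lipics.fsttcs.2022.12 p.2 (quantitative ε₀ remark, doubly-exponential shape;
class-level robustness);
in-tree NumTame.MagnitudeNF (universal magnitude normal form, unconditional, Boolean glue).
Delta: indexing Hrubeš's ε by the magnitude budget and conditioning the magnitude half on collapse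
turns "monotone→general transfer
(refuted)" into S ⟺ (  [refs: 10.4230/lipics.fsttcs.2022.12, paper:galaxy-pdf-8480837716326541740, doi-10-4230-lipics-fsttcs-2022-12, book:basu2006, doi:10.4230/lipics.fsttcs.2022.12]

Barriers (technique_class: monotone-sensitive, magnitude-nf, model-lifting): - technique_class: monotone-sensitive, magnitude-nf, model-lifting
- Literature.Barriers.ValiantsHypothesis.MonotoneGap: the refuted MonotoneLowerBoundsTransfer is
class-wide and ε-free; this line transfers nothing class-wide — its lower-bound piece is for per
only and its lifting piece is CONDITIONAL on collapse and budgeted; the ST ∈ VP witness is tame,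
hence sensitively easy in the line's window, consistent with the line.
- Literature.Barriers.ValiantsHypothesis.MonotoneGap (sensitive form, file
MonotoneGapSensitive.lean, theorem not_sensitiveTransfer): kills transfer at rate 2^-(ηn) for all
families; SmallConstPer/TameGrowth give easiness only at rate 2^-(n^C+C) with ∃C and only for per
under collapse — outside the quantifier range of the barrier.
- Literature.Barriers.ValiantsHypothesis.AlgebraicNaturalProofs: SensitiveHardPoly is a property of
ONE family implied by VP≠VNP itself (kernel), so it cannot be excluded as a statement; as a
technique, ε-sensitive discrepancy bounds are not rank-measure largeness arguments; the bet is that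
per's coefficient pattern has small rectangle discrepancy.
- Negatives index: 32 refuted statements (BarrierLever, rigidity, KPlusLogSqLaw, Elusive, …); none
concerns monotone, sensitive or tame computation — nothing to steer around.

History (route lifecycle, newest last):
- 2026-09-04T13:53:22Z · DORMANT — reconciler: no traction for 5 d (last activity statement-closed at 2026-08-30T13:01:39Z); parked, not closed — `ledger route dormant route-ValiantsHypothesis-Ta (operator:999:55578)

sub-problem: ValiantsHypothesis · status: dormant · opened planner-decomp-val-lens-6-g0-0 2026-08-29T18:02:57Z · rev 2 · ledger route-ValiantsHypothesis-TameSensitivity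
GENERATED by the gate from the ledger (D-0016/17). Provers cite these decls: `theorem foo : Summit.ValiantsHypothesis.ValiantsHypothesis.Theses.TameSensitivity.<Decl> := …` in Summits/ValiantsHypothesis/ValiantsHypothesis/Theorems/<Name>.lean.
-/

namespace Summit.ValiantsHypothesis.ValiantsHypothesis.Theses.TameSensitivity

open scoped BigOperators Topology Manifold Classical MeasureTheory ProbabilityTheory Matrix InnerProductSpace ComplexConjugate ContinuousMap
open Filter Set Function TopologicalSpace MeasureTheory

attribute [summit_statement] _root_.ValiantsHypothesis

open Literature.PNP

/-- item stmt-ValiantsHypothesis-23471 · crux · rank 2 · open · by planner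
why it might fail: large constants may genuinely help per under collapse: constant elimination (arithmetic Bézout) only yields height 2^(2^poly) for a fixed skeleton, and no collapse-to-magnitude mechanism is known (Koiran–Perifel 2011 Rem. 4).
sources: Burgisser2000, Burgisser2009, arXiv:0710.0360, doi:10.1007/3-540-33099-2
[crux] B1a — if per is p-computable over ℝ, then it is p-computable by fan-in-two real circuits
(gates of fan-in ≥ 1) whose constants and sum weights have modulus ≤ 2^(n^C + C) and whose formal
degrees are ≤ n^C + C, for some C. [difficulty: open-problem] -/
@[route_item "route-ValiantsHypothesis-TameSensitivity"]
def SmallConstPer : Prop :=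
  Literature.Computability.AlgebraicComplexity.IsPComputable (fun n => Literature.Computability.AlgebraicComplexity.perPoly (Fin n) ℝ) → ∃ (C : ℕ) (s : ℕ → ℕ), Literature.Computability.AlgebraicComplexity.IsPBounded s ∧ ∀ n : ℕ, ∃ P : Literature.Computability.AlgebraicComplexity.ArithCircuit ℝ (Fin n × Fin n), P.IsFanInTwo ∧ (∀ g ∈ P.gates, 1 ≤ g.fanIn) ∧ P.Computes (Literature.Computability.AlgebraicComplexity.perPoly (Fin n) ℝ) ∧ P.size ≤ s n ∧ (∀ c ∈ P.consts, |c| ≤ (2 : ℝ) ^ (n ^ C + C)) ∧ (∀ d ∈ Literature.Computability.AlgebraicComplexity.ArithCircuit.gateFormalDegrees P.gates, d ≤ n ^ C + C) ∧ P.formalDegree ≤ n ^ C + C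

/-- item stmt-ValiantsHypothesis-23472 · crux · rank 3 · open · by planner
why it might fail: U_n has full support, so every support-based monotone method is blind (Hrubeš 2020 p.6); discrepancy methods (CDM21/CDGM22) need a rectangle anti-concentration bound for per that is not in print; at large C it is as hard as per ∉ VP-with-radius-2^poly.
sources: Hrubes2020, doi:10.4230/lipics.fsttcs.2022.12, JerrumSnir1982, Yehudayoff2019
[crux] A — for every C and every p-bounded s there is an n such that for NO ε with 2^-(n^C+C) ≤ ε ≤
1 does (1 + Σ_ij x_ij)^n + ε·per_n admit a Jerrum–Snir monotone computation of size ≤ s n (budgeted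
ε-sensitive monotone hardness of the permanent, infinitely often). [difficulty: open-problem] -/
@[route_item "route-ValiantsHypothesis-TameSensitivity"]
def SensitiveHardPoly : Prop :=
  ∀ (C : ℕ) (s : ℕ → ℕ), Literature.Computability.AlgebraicComplexity.IsPBounded s → ∃ n : ℕ, ∀ ε : ℝ, ((2 : ℝ) ^ (n ^ C + C))⁻¹ ≤ ε → ε ≤ 1 → ¬ ∃ (g : MvPolynomial (Fin n × Fin n) NNReal) (P : Literature.Computability.AlgebraicComplexity.ArithCircuit NNReal (Fin n × Fin n)), MvPolynomial.map NNReal.toRealHom g = (1 + ∑ ij : Fin n × Fin n, MvPolynomial.X ij) ^ n + MvPolynomial.C ε * Literature.Computability.AlgebraicComplexity.perPoly (Fin n) ℝ ∧ Literature.Barriers.ValiantsHypothesis.IsMonotoneComputation P g ∧ P.size ≤ s n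

/-- item stmt-ValiantsHypothesis-23473 · support · rank 9 · closed · proved by Summit.ValiantsHypothesis.ValiantsHypothesis.Theorems.TameSensitivityQuantHrubes.quantHrubesPer (planner) · by planner
sources: Hrubes2020
[support] B2 — Hrubeš's Theorem 1 for per_n with explicit threshold: a p-bounded-preserving overhead
t such that every fan-in-two real circuit of size ≤ m computing per_n gives, for every 0 < ε ≤ 1
with ε·radius ≤ 1, a monotone computation of (1+Σx)^n + ε·per_n of size ≤ t n m (radius = abs-value
circuit at the all-ones point; Hrubeš's proof has ε₀ = 1/R ≥ 1/radius). [difficulty: provable-now] -/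
@[route_item "route-ValiantsHypothesis-TameSensitivity"]
def QuantHrubesPer : Prop :=
  ∃ t : ℕ → ℕ → ℕ, (∀ s : ℕ → ℕ, Literature.Computability.AlgebraicComplexity.IsPBounded s → Literature.Computability.AlgebraicComplexity.IsPBounded fun n => t n (s n)) ∧ ∀ (n : ℕ) (P : Literature.Computability.AlgebraicComplexity.ArithCircuit ℝ (Fin n × Fin n)) (m : ℕ), P.IsFanInTwo → P.Computes (Literature.Computability.AlgebraicComplexity.perPoly (Fin n) ℝ) → P.size ≤ m → ∀ ε : ℝ, 0 < ε → ε ≤ 1 → ε * MvPolynomial.eval (fun _ => (1 : ℝ)) (Literature.Computability.AlgebraicComplexity.ArithCircuit.mapConsts (fun c : ℝ => |c|) P).eval ≤ 1 → ∃ (g : MvPolynomial (Fin n × Fin n) NNReal) (Q : Literature.Computability.AlgebraicComplexity.ArithCircuit NNReal (Fin n × Fin n)), MvPolynomial.map NNReal.toRealHom g = (1 + ∑ ij : Fin n × Fin n, MvPolynomial.X ij) ^ n + MvPolynomial.C ε * Literature.Computability.AlgebraicComplexity.perPoly (Fin n) ℝ ∧ Literature.Barriers.ValiantsHypothesis.IsMonotoneComputation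 Q g ∧ Q.size ≤ t n m

/-- `QuantHrubesPer` holds: proved by `Summit.ValiantsHypothesis.ValiantsHypothesis.Theorems.TameSensitivityQuantHrubes.quantHrubesPer`. -/
theorem QuantHrubesPer_holds : QuantHrubesPer := _root_.Summit.ValiantsHypothesis.ValiantsHypothesis.Theorems.TameSensitivityQuantHrubes.quantHrubesPer

/-- item stmt-ValiantsHypothesis-23474 · support · rank 9 · closed · proved by Summit.ValiantsHypothesis.ValiantsHypothesis.Theorems.TameSensitivityGrowth.tameGrowth (planner) · by planner
sources: Burgisser2000, Burgisser2009
[support] B1b — growth lemma for the radius: a fan-in-two real circuit with gates of fan-in ≥ 1,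
constants and weights of modulus ≤ 2^R and all formal degrees ≤ D has abs-value evaluation at the
all-ones point ≤ 2^((R+1)·D·(size+2)) (induction over the gate list; abs-evaluation twin of
NumTame.MagnitudeGlue). [difficulty: provable-now] -/
@[route_item "route-ValiantsHypothesis-TameSensitivity"]
def TameGrowth : Prop :=
  ∀ (n R D : ℕ) (P : Literature.Computability.AlgebraicComplexity.ArithCircuit ℝ (Fin n × Fin n)), P.IsFanInTwo → (∀ g ∈ P.gates, 1 ≤ g.fanIn) → (∀ c ∈ P.consts, |c| ≤ (2 : ℝ) ^ R) → (∀ d ∈ Literature.Computability.AlgebraicComplexity.ArithCircuit.gateFormalDegrees P.gates, d ≤ D) → P.formalDegree ≤ D → MvPolynomial.eval (fun _ => (1 : ℝ)) (Literature.Computability.AlgebraicComplexity.ArithCircuit.mapConsts (fun c : ℝ => |c|) P).eval ≤ (2 : ℝ) ^ ((R + 1) * D * (P.size + 2))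

/-- `TameGrowth` holds: proved by `Summit.ValiantsHypothesis.ValiantsHypothesis.Theorems.TameSensitivityGrowth.tameGrowth`. -/
theorem TameGrowth_holds : TameGrowth := _root_.Summit.ValiantsHypothesis.ValiantsHypothesis.Theorems.TameSensitivityGrowth.tameGrowth

/-- item stmt-ValiantsHypothesis-23475 · assembly · rank 1 · closed · proved by Summit.ValiantsHypothesis.ValiantsHypothesis.Theorems.TameSensitivityAssembly.assembly_holds (planner) · by planner
sources: Hrubes2020, Burgisser2000
[assembly] SensitiveHardPoly → QuantHrubesPer → SmallConstPer → TameGrowth → ValiantsHypothesis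
(proved sorry-free as `closes_tame` in the node file
pub/decomp-valiant/decomp-val-lens-6/TameSensitivity.lean; a prover ports it verbatim). -/
@[route_item "route-ValiantsHypothesis-TameSensitivity"]
def Assembly : Prop :=
  SensitiveHardPoly → QuantHrubesPer → SmallConstPer → TameGrowth → _root_.ValiantsHypothesis

-- `Assembly` holds: proved by `Summit.ValiantsHypothesis.ValiantsHypothesis.Theorems.TameSensitivityAssembly.assembly_holds` (its module imports this route file, so no `_holds` link can be stated here).

/-! D-0027 §2.1 — DECIDING THEOREM (planner-authored via `route open/edit --closes-file`; by planner-decomp-val-lens-6-g13-0 2026-08-30T08:32:25Z):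
its hypotheses are this route's items and its conclusion the sub-problem Statement (glue_lint), and it elaborates with this file. -/

@[closes "route-ValiantsHypothesis-TameSensitivity"] theorem closes (hA : SensitiveHardPoly) (hQ : QuantHrubesPer) (hS : SmallConstPer) (hG : TameGrowth) :
    _root_.ValiantsHypothesis := by
  refine Literature.Computability.AlgebraicComplexity.perNotPComputableComplex_iff_holds.mp ?_
  intro hVPC
  have hVP : Literature.Computability.AlgebraicComplexity.IsPComputable
      (fun n => Literature.Computability.AlgebraicComplexity.perPoly (Fin n) ℝ) :=
    Summit.ValiantsHypothesis.ValiantsHypothesis.Theorems.SymmetroidDescartes.isPComputable_perPoly_real_of_complex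
      hVPC
  -- B1a: circuits for per with small constants and formal degrees
  obtain ⟨C, s, hs, hP⟩ := hS hVP
  -- the radius exponent is p-bounded
  have he : Literature.Computability.AlgebraicComplexity.IsPBounded
      fun n => (n ^ C + C + 1) * (n ^ C + C) * (s n + 2) :=
    Literature.Computability.AlgebraicComplexity.IsPBounded.mul_holds
      (Literature.Computability.AlgebraicComplexity.IsPBounded.mul_holds
        (Literature.Computability.AlgebraicComplexity.IsPBounded.add_holds
          (Literature.Computability.AlgebraicComplexity.IsPBounded.add_holds
            (Literature.Computability.AlgebraicComplexity.IsPBounded.pow_holds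
              Literature.Computability.AlgebraicComplexity.IsPBounded.id C)
            (Literature.Computability.AlgebraicComplexity.IsPBounded.const C))
          (Literature.Computability.AlgebraicComplexity.IsPBounded.const 1))
        (Literature.Computability.AlgebraicComplexity.IsPBounded.add_holds
          (Literature.Computability.AlgebraicComplexity.IsPBounded.pow_holds
            Literature.Computability.AlgebraicComplexity.IsPBounded.id C)
          (Literature.Computability.AlgebraicComplexity.IsPBounded.const C)))
      (Literature.Computability.AlgebraicComplexity.IsPBounded.add_holds hs
        (Literature.Computability.AlgebraicComplexity.IsPBounded.const 2))
  obtain ⟨c', hc'⟩ := he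
  -- B2: the quantitative Hrubeš simulation
  obtain ⟨t, ht, hH⟩ := hQ
  -- A at budget c' and size bound t n (s n)
  obtain ⟨n, hn⟩ := hA c' (fun n => t n (s n)) (ht s hs)
  obtain ⟨P, hfan, hfan1, hcomp, hsize, hconst, hdeg, hdegout⟩ := hP n
  -- radius of P_n ≤ 2^(n^c' + c')  (B1b)
  have habs : MvPolynomial.eval (fun _ => (1 : ℝ))
      (Literature.Computability.AlgebraicComplexity.ArithCircuit.mapConsts (fun c : ℝ => |c|) P).eval ≤
        (2 : ℝ) ^ (n ^ c' + c') := by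
    calc _ ≤ (2 : ℝ) ^ ((n ^ C + C + 1) * (n ^ C + C) * (P.size + 2)) :=
          hG n (n ^ C + C) (n ^ C + C) P hfan hfan1 hconst hdeg hdegout
      _ ≤ (2 : ℝ) ^ ((n ^ C + C + 1) * (n ^ C + C) * (s n + 2)) := by
          gcongr
          · norm_num
      _ ≤ (2 : ℝ) ^ (n ^ c' + c') := by
          gcongr
          · norm_num
          · exact hc' n
  have hrpos : (0 : ℝ) < ((2 : ℝ) ^ (n ^ c' + c'))⁻¹ := by positivity
  have hrle : ((2 : ℝ) ^ (n ^ c' + c'))⁻¹ ≤ 1 :=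
    inv_le_one_of_one_le₀ (one_le_pow₀ (by norm_num))
  refine hn _ le_rfl hrle (hH n P (s n) hfan hcomp hsize _ hrpos hrle ?_)
  calc ((2 : ℝ) ^ (n ^ c' + c'))⁻¹ * MvPolynomial.eval (fun _ => (1 : ℝ))
        (Literature.Computability.AlgebraicComplexity.ArithCircuit.mapConsts (fun c : ℝ => |c|) P).eval
        ≤ ((2 : ℝ) ^ (n ^ c' + c'))⁻¹ * (2 : ℝ) ^ (n ^ c' + c') :=
        mul_le_mul_of_nonneg_left habs hrpos.le
    _ = 1 := inv_mul_cancel₀ (pow_ne_zero _ two_ne_zero)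

end Summit.ValiantsHypothesis.ValiantsHypothesis.Theses.TameSensitivity
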